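import Summits.QuantumFields.QCD.Theses.NestedDissectionSea
import Literature.MathematicalPhysics.QuantumLattice.WilsonPositivityDomain
import Summits.QuantumFields.QCD.Theorems.RobustYangMillsHandover.Negative.SchemeAsymptotics

/-!
# Disproof of `NegativeCellsDilute` (stmt-QuantumFields-13900) — standing disprover's work file

Findings (cycle 2, refuter-cdisprove-stmt-QuantumFields-13900-g2-0, 2026-08-16; v5 — §§ 3–6 new,
all sorry-free, standard axioms; NO KILL):

* § 3 `not_negativeCellsDiluteUniformPin` — the NATURAL STRENGTHENING with clause (b) uniform in
  the depth (`∀ᶠ k, ∀ M > M₀` instead of `∀ M > M₀, ∀ᶠ k`) is FALSE for every regularisation: at a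
  fixed step a depth `M ≥ (mcrit k + 9) Z_m/a_k` puts the probe below `−8` (empty pin event, § 1).
  The quantifier order of (b) is load-bearing; `k₀(M)` must grow with `M` (physically: the probe
  must stay in the physical branch, `a_k M/Z_m ≪ |m_c(β_k)|`). LANDED (p76812, commit 99673e0aea9b; p76501 was the same file bounced by a gate restart) as
  `Theorems/NegativeCellsDilute/Negative/UniformPinFalse.lean` with `mcrit_eventually_lt`.
* § 4 `crux_of_highLinePin` / `crux_sandwich` — `HighLinePin → NegativeCellsDilute → Pin`: the
  crux is IMPLIED by its pin clause alone along any admissible line keeping the valence masses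
  positive (`mcrit k ≥ −a_k M₀/Z_m k`; clause (a) then holds with `δ ≡ 0`). Hence the ENTIRE content
  of the crux beyond the bare pin is "no high line carries the pin" — a Lifshitz-tail statement
  (real eigenvalue of `K_U` within `a_k M/Z_m → 0` of the spectral edge `4`, w.p. `≥ 1/4` at weak
  coupling) which is physics-false but NOT in the tree. Reviewers of a claimed proof must check the
  line: a proof along a high line proves `HighLinePin`, not chiral physics.
* § 5 `mcrit_eventually_lt` — pin + `HasMassScaling` ⇒ `∀ η > 0, ∀ᶠ k, mcrit k < η`
  (`limsup mcrit ≤ 0`; the window of § 1 closes because `Z_m → ∞`, sibling lemma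
  `RobustYangMillsHandover.Negative.tendsto_massIncrement_zero`).
* § 6 `signDefectForcesCrossing` — route item `SignDefectForcesCrossing` (stmt-13898) PROVED
  verbatim (candidate proof attached there as `Crossing.lean`); torus analogue
  `exists_fermionDet_eq_zero_of_re_neg` / `pinEvent_forces_crossing`: the pin event at probe `μ`
  forces a real-mode crossing in `(μ, 0]`. The pin is a crossing-parity event.
* Physics re-audit (why it still resists). (b) on the honest line `mcrit ≈ m_c(β_k)`: crossings
  above the probe `m_c − a_kM/Z_m` are asymptotically exactly the physical index modes (they sit
  within `O(a_k²)` lattice units of `m_c`; objects of size `ρ ≲ (a_k Z_m/M)^{1/2}` (physical) are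
  excluded but have density `→ 0` since `b = 11 − 2N_f/3 > 4`); I–Ā pairs give a complex pair or
  two real crossings — parity `≡ Q (mod 2)` either way; `P(Q odd) ≥ 1/4` once `χ_t R⁴ ≳ 0.35`, and
  `R = R(m)` is the prover's. (a): the valence offset `a_k m/Z_m` is parametrically LARGER than the
  `O(a_k²)` spread of physical crossing points (Symanzik: crossing masses of physical modes carry
  `O(a)` cutoff effects in physical units; CLT for the mode-averaged tadpole gives std
  `≍ g² a_k²/ρ²`), so a physical mode is an early crosser only at `≍ m ρ²/(g² Z_m a_k) → ∞` standard
  deviations / LD cost `≍ ρ⁴/(a_k² g⁴)`; lattice-scale objects cross deep (`m_c − c/r²`) and their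
  early-crossing LD cost `≍ c²/g₀⁴` is size-independent while their window count carries
  `(a_kΛ)^{b−4} → 0`. No carrier population with non-vanishing early-crossing rate per physical
  volume was found; the named failure mode (Aoki band `∝ a` rather than `a³`) is absorbed by `M₀`
  unless the band is `≫ a_k/Z_m`, for which there is no evidence (WχPT: width `∝ a²` in physical
  units = `a³` lattice). Numerics queued on the saturated farm: kit j010655 (`torus_sign.py`,
  `--workitem`): `P(det D_W < 0)` vs `μ` on odd tori `N = 1, 3, 5` for Haar / near-identity SU(3),
  real-eigenvalue counts of `K_U`, and an exact-witness search on `N = 1` (tightness of `[−8, 0]`).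

Findings (cycle 1, refuter-cdisprove-stmt-QuantumFields-13900-0, 2026-08-16; v4):

* The crux elaborates verbatim (probe rc 0). Shape: `∀ Nf ∈ {2,3} ∃ reg (HasMassScaling,
  HasAsymptoticScaling) ∃ M₀ b₀ ℓ ∀ m > M₀ ∃ R, (a) windowed dilution ∧ (b) parity pin`.
* NO KILL. Everything decidable from the tree is settled below and none of it bites:
  - § 1 `pin_window`: the pin integrand vanishes for EVERY gauge field whenever the probe mass
    `mcrit k − a_k M/Z_m k` is `> 0` (Seiler positivity, tree) or `< −8` (mirror Neumann homotopy,
    `fermionDet_wilsonDirac_re_pos_of_abs`), so clause (b) forces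
    `mcrit k − a_k M/Z_m k ∈ [−8, 0]` for every `M > M₀`, eventually in `k`
    (`limsup mcrit_k Z_m(k)/a_k ≤ M₀`). Junk witnesses `mcrit ≡ c > 0`, `→ +∞`, `≡ c < −8` are dead.
  - § 2 `withoutPin_holds`: with clause (b) DELETED the crux is TRIVIALLY TRUE — along the heavy
    junk regularisation `mcrit ≡ 1` every valence mass is positive and NO box is ever a sign defect
    (`not_isSignDefect_of_pos`, from `block_det_re_pos`: every principal minor of `D_W(U, μ, 1)`,
    `μ > 0`, is real and positive — route item `DirichletDetReal` is the by-product `block_det_im`).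
    So the pin is the SOLE carrier of content: any proof must produce odd spectral index with
    probability `≥ 1/4` on tori of physical side `≥ R` — parity mixing of lattice topological
    charge under the phase-quenched SU(3) measure at weak coupling (Yang–Mills-hard), and any
    disproof must bound that probability `< 1/4` for EVERY admissible `reg` — equally out of reach.
  - measure/integral junk: `wilsonMeasure = Z⁻¹ e^{−βS} Haar^E` is a genuine probability measure,
    `∏_f |det D_W|` is continuous and a.e. positive; a `0`-valued junk integral could only make (b)
    FALSE for the prover (never true) and (a) easier; the `δ`-sign slack of (a) is vacuous only on
    tori smaller than the window top (choose `R > ℓ`): cosmetic (refuter rattack, confirmed).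
* WHY IT RESISTS (physics reading, for the provers). (b): crossings above the probe
  `m_c − a_kM/Z_m` = all physical index modes (they cross within `O(a_k²)` of the line) ⇒ parity
  `≈ Q mod 2`, `P(Q odd) → 1/2` on large tori, `≥ 1/4` once `χ_t R⁴ ≳ 0.35`. (a): a sign defect
  needs an EARLY CROSSER — a real eigenvalue of a Dirichlet cell with Wilson energy
  `< |m_c(β_k)| − a_k m/Z_m`. Classification of real-eigenvalue carriers near the line:
  (i) chiral lumps of size `ρ`: cross at `m_c − c_I/ρ²`, BELOW the line; lifting one above the
  valence mass needs a first-order response `ξ > c_I/ρ²` against `std ξ ≍ c₁ g(ρ)/ρ²`, an LD of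
  probability `(ρa_kΛ)^{b'}`, `b' ≥ 0`, on top of the density `(ρa_kΛ)^b ρ^{−5}`,
  `b = 11 − 2N_f/3 > 4` — summable over the window with NO constant condition (planner's L5;
  I concur); (ii) PAIR-COLLISION real modes (the item's named failure mode): they are born from two
  low Dirac modes of a smooth field whose Wilson energy is `|m_c| + a²p²/2 ≥ |m_c|` up to
  `O(g² a²/ρ²)`, i.e. they land within `O(a_k²) ≪ a_k m/Z_m` BELOW the line — between the probe
  and the valence mass — and always in pairs: invisible to (a) (not early) AND to (b) (parity
  `± 2`); only pairs born within the tiny non-normal splitting of a threshold matter, and at the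
  valence threshold there are none without a cold well. So the named failure mode does NOT bite as
  stated; (iii) COLD WELLS (block-averaged Wilson energy of a smooth trial mode below the bulk
  tadpole by `2π²/s² + h`): CLT/LD rate `exp(−c/g₀⁴) = exp(−cβ²)` per region against window entropy
  `exp(β/b₀)` — wins asymptotically; (iv) dislocations (`ρ ≲ 1.5/g₀`): kinematically excluded
  (Wilson energy `≳ 1/ρ² > |m_c| ≍ 0.43 g₀²`). The two non-rigorous steps a prover must supply:
  the LD bound (iii) for the phase-quenched SU(3) measure up to the window scale (a Bałaban
  small-field statement), and COMPLETENESS of the classification (i)–(iv) of real eigenvalues of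
  Dirichlet Wilson cells in the band `[λ_min(B_U), |m_c|)` (≈ `[0.7, 1]·|m_c|` at one loop, which
  the numerical range does NOT exclude — FINDINGS-ideator1 §1). A disproof would have to exhibit a
  FIFTH carrier population with density per lattice site `≫ a_k⁴ ≍ e^{−β_k/b₀}`; I found none.

* ATTACK 5 (dead, recorded for provers): DISSECTION WALLS AS SUPERCRITICAL DEFECTS. The cells are
  principal submatrices — artificial Dirichlet sheets the gauge field does not see. Could the
  sheets renormalise the cell's critical mass UPWARD (cell modes crossing above the bulk line with
  probability 1 at some scale n(β) inside the window ⇒ Σδ_j ≥ O(1) ⇒ ¬(a))? Budget for the lowest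
  Dirichlet mode of a cell of side n: Wilson energy = |m_c| + kinetic floor (+2π²/n², KineticEdge,
  deterministic, any field) + wall-induced additive self-energy shift δ_w(n) + fluctuations. At
  mean-field/tadpole level δ_w ≥ 0 exactly (E_cell(ψ) = 4(1−u)‖ψ‖² + u·E_free,cell(ψ), confinement
  only raises). Beyond: the additive mass renormalisation is UV-local up to chirally suppressed
  O(ak) corrections, so modifying the quark propagator at distance d from a sheet changes the local
  additive self-energy by O(g₀²/d²), and the Dirichlet mode (weight ∝ d²/n³ at distance d) shifts
  by O(g₀²/n²) — the Schrödinger-functional analogue is the O(a) boundary effect a·m ≍ c g₀² a²/L².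
  Hence |δ_w| ≲ c_b g₀²/n² against +2π²/n²: the floor wins by 2π²/(c_b g₀²) → ∞ along asymptotic
  scaling. No deterministic early crossers from the dissection itself, eventually in k; at CLS
  couplings the margin is a one-loop computable SF-type boundary coefficient (not needed by the
  crux, which is asymptotic).
* Finite check queued: kit j009116 (`freecell.py`): does the FREE / near-free Dirichlet cell have
  REAL eigenvalues in the physical branch at all (cold-well carrier (iii) deterministic or not)?
  Results auto-attach to the item; to be folded in at the next boundary.

Sections (cycle 2 adds § 3 uniform pin refuted, § 4 sandwich, § 5 mcrit asymptotics, § 6 crossings,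
§ 7 quantitative margins, § 8 numerics):
§ 1 pin window (proved; LANDED one-sided — upper bound `mcrit k − a_k M/Z_m k ≤ 0` from
the tree's Seiler lemma — as `Theorems/NegativeCellsDilute/Negative/PinWindow.lean`, p73937, commit
82fdab13498c, namespace `Summit.QuantumFields.QCD.Theorems.NegativeCellsDilutePinWindow`; the `−8`
side is `CoerciveSeaNegative.fermionDet_wilsonDirac_re_pos_of_pos_or_lt` in the hinge disprover's
`Theorems/CoerciveSea/Negative/SeilerBothSides.lean`). § 2
Dirichlet-cell positivity at positive bare mass, the pin-less crux holds trivially (proved; LANDED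
as `Theorems/NegativeCellsDilute/Negative/CellPositivity.lean`, p73361, commit f0647dc5d6fb —
importable: `Summit.QuantumFields.QCD.Theorems.NegativeCellsDiluteCellPositivity.*`). All
declarations sorry-free, axioms standard.
-/


noncomputable section

namespace Summit.QuantumFields.QCD.Cruxes.NegativeCellsDilute.Disproof

open MeasureTheory Filter Matrix
open Literature.MathematicalPhysics.QuantumLattice Literature.MathematicalPhysics.QuantumFieldTheory
  Literature.Probability.LatticeModels

/-- Local notation: the colour group `SU(3)`. -/
local notation "𝔾" => Matrix.specialUnitaryGroup (Fin 3) ℂ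

/-- The fundamental representation of `SU(3)` is unitary (tree). -/
theorem fund_unitary : ∀ g : 𝔾, fundamentalRep (Fin 3) g ∈ Matrix.unitaryGroup (Fin 3) ℂ :=
  fun g => fundamentalRep_mem_unitaryGroup g

/-! ## § 1. The pin window: `Re det D_W(U, μ, 1) > 0` for `μ > 0` and for `μ < −8` -/

section SeilerMirror

variable {L N : ℕ} [NeZero L] {G : Type*} [Group G] (ρ : G →* Matrix (Fin N) (Fin N) ℂ)

section L2

open scoped Matrix.Norms.L2Operator

/-- Neumann: for `|m + 4| > 4` and `t ∈ [0,1]` the homotopy matrix `1 − (t/(m+4)) K` is a unit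
(`‖K‖ ≤ 4`). Mirror of the tree's `isUnit_segMatrix` (which assumes `m > 0`). -/
theorem isUnit_segMatrix_abs (hρ : ∀ g, ρ g ∈ Matrix.unitaryGroup (Fin N) ℂ)
    (U : GaugeConfig 4 L G) {m t : ℝ} (hm : 4 < |m + 4|) (ht0 : 0 ≤ t) (ht1 : t ≤ 1) :
    IsUnit ((1 - ((t / (m + 4) : ℝ) : ℂ) • ∑ μ, wilsonHop ρ U μ)) := by
  have hK := l2_opNorm_sum_wilsonHop_le ρ hρ U
  have h4 : (0 : ℝ) < |m + 4| := by linarith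
  have hnorm : ‖((t / (m + 4) : ℝ) : ℂ) • ∑ μ, wilsonHop ρ U μ‖ < 1 := by
    rw [norm_smul, Complex.norm_real, Real.norm_eq_abs, abs_div, abs_of_nonneg ht0]
    calc t / |m + 4| * ‖∑ μ, wilsonHop ρ U μ‖ ≤ 1 / |m + 4| * 4 := by
          apply mul_le_mul _ hK (norm_nonneg _) (by positivity)
          exact div_le_div_of_nonneg_right ht1 h4.le
      _ < 1 := by
          rw [div_mul_eq_mul_div, one_mul, div_lt_one h4]; exact hm
  exact ⟨Units.oneSub _ hnorm, rfl⟩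

/-- Hence `det M_t ≠ 0` on the segment. -/
theorem det_segMatrix_ne_zero_abs (hρ : ∀ g, ρ g ∈ Matrix.unitaryGroup (Fin N) ℂ)
    (U : GaugeConfig 4 L G) {m t : ℝ} (hm : 4 < |m + 4|) (ht0 : 0 ≤ t) (ht1 : t ≤ 1) :
    ((1 - ((t / (m + 4) : ℝ) : ℂ) • ∑ μ, wilsonHop ρ U μ)).det ≠ 0 :=
  ((Matrix.isUnit_iff_isUnit_det _).mp (isUnit_segMatrix_abs ρ hρ U hm ht0 ht1)).ne_zero

end L2

omit [NeZero L] in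
/-- For `t > 0` the homotopy matrix is a rescaled Wilson–Dirac matrix at bare mass
`(m+4)/t − 4` (only `m + 4 ≠ 0` is needed). -/
theorem segMatrix_eq_smul_wilsonDirac_ne (hρ : ∀ g, ρ g ∈ Matrix.unitaryGroup (Fin N) ℂ)
    (U : GaugeConfig 4 L G) {m t : ℝ} (hm : m + 4 ≠ 0) (ht : 0 < t) :
    (1 - ((t / (m + 4) : ℝ) : ℂ) • ∑ μ, wilsonHop ρ U μ) =
      ((t / (m + 4) : ℝ) : ℂ) • wilsonDirac ρ U ((m + 4) / t - 4) 1 := by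
  rw [wilsonDirac_eq_sub_sum_wilsonHop ρ hρ, smul_sub, smul_smul, ← Complex.ofReal_mul,
    show t / (m + 4) * ((m + 4) / t - 4 + 4) = 1 by field_simp; ring, Complex.ofReal_one,
    one_smul]

/-- `det M_t` is real (γ₅-hermiticity), for any `m` with `m + 4 ≠ 0`. -/
theorem det_segMatrix_im_ne (hρ : ∀ g, ρ g ∈ Matrix.unitaryGroup (Fin N) ℂ)
    (U : GaugeConfig 4 L G) {m t : ℝ} (hm : m + 4 ≠ 0) (ht0 : 0 ≤ t) :
    (((1 - ((t / (m + 4) : ℝ) : ℂ) • ∑ μ, wilsonHop ρ U μ)).det).im = 0 := by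
  rcases ht0.eq_or_lt with h | ht
  · subst h; simp
  · rw [segMatrix_eq_smul_wilsonDirac_ne ρ hρ U hm ht, det_smul]
    have hreal := fermionDet_wilsonDirac_im_holds (L := L) ρ hρ U ((m + 4) / t - 4) 1
    set d := (wilsonDirac ρ U ((m + 4) / t - 4) 1).det with hd
    have hd' : d = ((d.re : ℝ) : ℂ) := Complex.ext (by simp) (by simpa using hreal)
    rw [hd', ← Complex.ofReal_pow, ← Complex.ofReal_mul, Complex.ofReal_im]

/-- The Wilson index set has even cardinality (four spin components). -/
theorem even_card_index : Even (Fintype.card (TorusSite 4 L × Fin N × Fin 4)) := by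
  simp only [Fintype.card_prod, Fintype.card_fin]
  exact ⟨Fintype.card (TorusSite 4 L) * (N * 2), by ring⟩

/-- **Two-sided Seiler positivity.** For `|m + 4| > 4`, i.e. bare mass `m > 0` OR `m < −8`, the
Wilson determinant is strictly positive for EVERY gauge field: the hopping matrix has norm `≤ 4`,
so along `t ↦ 1 − (t/(m+4))K` the determinant is real, continuous, non-zero and `= 1` at `t = 0`,
hence positive at `t = 1`; `det D_W = (m+4)^n det M_1` with `n` even. (Tree: the case `m > 0`,
`fermionDet_wilsonDirac_re_pos`.) -/
theorem fermionDet_wilsonDirac_re_pos_of_abs (hρ : ∀ g, ρ g ∈ Matrix.unitaryGroup (Fin N) ℂ)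
    (U : GaugeConfig 4 L G) {m : ℝ} (hm : 4 < |m + 4|) :
    0 < (fermionDet (wilsonDirac ρ U m 1)).re := by
  have hm0 : m + 4 ≠ 0 := by
    intro h; rw [h, abs_zero] at hm; linarith
  set g : ℝ → ℝ := fun t => (((1 - ((t / (m + 4) : ℝ) : ℂ) • ∑ μ, wilsonHop ρ U μ)).det).re
    with hgdef
  have hg : Continuous g := Complex.continuous_re.comp (continuous_det_segMatrix ρ U m)
  have hg0 : g 0 = 1 := by simp [hgdef]
  have hne : ∀ t ∈ Set.Icc (0 : ℝ) 1, g t ≠ 0 := by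
    intro t ht h0
    apply det_segMatrix_ne_zero_abs ρ hρ U hm ht.1 ht.2
    exact Complex.ext (by simpa [hgdef] using h0) (by simpa using det_segMatrix_im_ne ρ hρ U hm0 ht.1)
  have hg1 : 0 < g 1 := by
    refine lt_of_not_ge fun hle => ?_
    have hmem : (0 : ℝ) ∈ Set.Icc (g 1) (g 0) := ⟨hle, by rw [hg0]; norm_num⟩
    obtain ⟨t, ht, ht0⟩ := intermediate_value_Icc' zero_le_one hg.continuousOn hmem
    exact hne t ht ht0
  have hD : wilsonDirac ρ U m 1 =
      ((m + 4 : ℝ) : ℂ) • (1 - ((1 / (m + 4) : ℝ) : ℂ) • ∑ μ, wilsonHop ρ U μ) := by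
    rw [smul_sub, smul_smul, ← Complex.ofReal_mul,
      show (m + 4) * (1 / (m + 4)) = 1 by field_simp, Complex.ofReal_one, one_smul,
      wilsonDirac_eq_sub_sum_wilsonHop ρ hρ]
  have hdet : fermionDet (wilsonDirac ρ U m 1) =
      (((m + 4) ^ Fintype.card (TorusSite 4 L × Fin N × Fin 4) * g 1 : ℝ) : ℂ) := by
    rw [fermionDet, hD, det_smul]
    have him := det_segMatrix_im_ne ρ hρ U hm0 zero_le_one
    set d := ((1 - ((1 / (m + 4) : ℝ) : ℂ) • ∑ μ, wilsonHop ρ U μ)).det with hd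
    have hd' : d = ((d.re : ℝ) : ℂ) := Complex.ext (by simp) (by simpa using him)
    rw [hd', ← Complex.ofReal_pow, ← Complex.ofReal_mul]
  rw [hdet, Complex.ofReal_re]
  exact mul_pos (even_card_index.pow_pos hm0) hg1

/-- The case `m < −8`. -/
theorem fermionDet_wilsonDirac_re_pos_of_lt_neg_eight (hρ : ∀ g, ρ g ∈ Matrix.unitaryGroup (Fin N) ℂ)
    (U : GaugeConfig 4 L G) {m : ℝ} (hm : m < -8) :
    0 < (fermionDet (wilsonDirac ρ U m 1)).re :=
  fermionDet_wilsonDirac_re_pos_of_abs ρ hρ U (by rw [abs_of_neg (by linarith)]; linarith)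

end SeilerMirror

/-! ### The pin integrand and ratio -/

/-- The pin event indicator at probe mass `μ` (verbatim the statement's `if … then 1 else 0`). -/
def pinIndicator {N : ℕ} [NeZero N] (μ : ℝ) (U : GaugeConfig 4 N 𝔾) : ℝ :=
  if (fermionDet (wilsonDirac (fundamentalRep (Fin 3)) U μ 1)).re < 0 then 1 else 0

/-- The phase-quenched pin ratio at coupling `β`, probe mass `μ`, weight `wt` (verbatim). -/
def pinRatio {N : ℕ} [NeZero N] (β μ : ℝ) (wt : GaugeConfig 4 N 𝔾 → ℝ) : ℝ :=
  (∫ U, pinIndicator μ U * wt U ∂(wilsonMeasure (d := 4) (L := N) (fundamentalRep (Fin 3)) β)) /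
    (∫ U, wt U ∂(wilsonMeasure (d := 4) (L := N) (fundamentalRep (Fin 3)) β))

/-- Outside `[−8, 0]` the pin indicator vanishes for EVERY gauge field. -/
theorem pinIndicator_eq_zero {N : ℕ} [NeZero N] {μ : ℝ} (hμ : 0 < μ ∨ μ < -8)
    (U : GaugeConfig 4 N 𝔾) : pinIndicator μ U = 0 := by
  unfold pinIndicator
  rw [if_neg]
  rcases hμ with h | h
  · exact not_lt.mpr (fermionDet_wilsonDirac_re_pos _ fund_unitary U h).le
  · exact not_lt.mpr (fermionDet_wilsonDirac_re_pos_of_lt_neg_eight _ fund_unitary U h).le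

/-- Hence the pin ratio is `0` there — for every torus, coupling and weight. -/
theorem pinRatio_eq_zero {N : ℕ} [NeZero N] (β : ℝ) {μ : ℝ} (hμ : 0 < μ ∨ μ < -8)
    (wt : GaugeConfig 4 N 𝔾 → ℝ) : pinRatio β μ wt = 0 := by
  simp [pinRatio, pinIndicator_eq_zero hμ]

/-- So the pin inequality `1/4 ≤ P(Re det < 0)` FAILS deterministically at such probe masses. -/
theorem not_pin_at {N : ℕ} [NeZero N] (β : ℝ) {μ : ℝ} (hμ : 0 < μ ∨ μ < -8)
    (wt : GaugeConfig 4 N 𝔾 → ℝ) : ¬ ((1 / 4 : ℝ) ≤ pinRatio β μ wt) := by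
  rw [pinRatio_eq_zero β hμ wt]; norm_num

/-! ### Clause (b) verbatim, and the window it forces on `reg.mcrit` -/

/-- Clause (b) of `NegativeCellsDilute` for given `reg`, mass tuple `m`, threshold `M₀`, size `R`
(VERBATIM the second conjunct of the crux body). -/
def PinClause {Nf : ℕ} (reg : QCDRegularisation Nf) (m : Fin Nf → ℝ) (M₀ R : ℝ) : Prop :=
  ∀ M : ℝ, M₀ < M → ∀ᶠ k : ℕ in Filter.atTop, ∀ S : ℕ, R ≤ reg.a k * (2 * S + 1) →
    let N : ℕ := 2 * S + 1
    let mq : Fin Nf → ℝ := fun f => reg.mcrit k + reg.a k * m f / reg.Zm k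
    let wt : GaugeConfig 4 N 𝔾 → ℝ :=
      fun U => ∏ f, ‖fermionDet (wilsonDirac (fundamentalRep (Fin 3)) U (mq f) 1)‖
    (1 / 4 : ℝ) ≤ (∫ U, (if (fermionDet (wilsonDirac (fundamentalRep (Fin 3)) U
        (reg.mcrit k - reg.a k * M / reg.Zm k) 1)).re < 0 then (1 : ℝ) else 0) * wt U
          ∂(wilsonMeasure (d := 4) (L := N) (fundamentalRep (Fin 3)) (reg.β k))) /
      (∫ U, wt U ∂(wilsonMeasure (d := 4) (L := N) (fundamentalRep (Fin 3)) (reg.β k)))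

/-- The crux projects onto its pin clause (certifies that `PinClause` is verbatim). -/
theorem pinClause_of_crux (h : Theses.NestedDissectionSea.NegativeCellsDilute) :
    ∀ Nf : ℕ, (Nf = 2 ∨ Nf = 3) → ∃ reg : QCDRegularisation Nf, ∃ M₀ : ℝ, 0 ≤ M₀ ∧
      ∀ m : Fin Nf → ℝ, (∀ f, M₀ < m f) → ∃ R : ℝ, 0 < R ∧ PinClause reg m M₀ R := by
  intro Nf hNf
  obtain ⟨reg, -, -, M₀, hM₀, b₀, -, ℓ, -, h⟩ := h Nf hNf
  refine ⟨reg, M₀, hM₀, fun m hm => ?_⟩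
  obtain ⟨R, hR, -, hb⟩ := h m hm
  exact ⟨R, hR, hb⟩

/-- Every torus size beyond `R / a_k` is admissible: the clause is never vacuous in `S`. -/
theorem exists_admissible_S {Nf : ℕ} (reg : QCDRegularisation Nf) (R : ℝ) (k : ℕ) :
    ∃ S : ℕ, R ≤ reg.a k * (2 * S + 1) := by
  have ha := reg.a_pos k
  refine ⟨⌈R / reg.a k⌉₊, ?_⟩
  have h1 : R / reg.a k ≤ (⌈R / reg.a k⌉₊ : ℝ) := Nat.le_ceil _
  have h2 : R ≤ reg.a k * (⌈R / reg.a k⌉₊ : ℝ) := by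
    rw [div_le_iff₀ ha] at h1; linarith
  nlinarith

/-- **Pin window.** If clause (b) holds then, for every `M > M₀`, eventually in `k` the probe mass
`mcrit k − a_k M / Z_m k` lies in `[−8, 0]`: the pin pins `reg.mcrit` from both sides
(`limsup_k mcrit_k Z_m(k)/a_k ≤ M₀`, `mcrit_k ≥ −8 − o(1)`). The junk witnesses `mcrit ≡ c > 0`,
`mcrit → +∞`, `mcrit ≡ c < −8` are thereby dead; `mcrit ≡ 0` survives this lemma but (heuristically)
not (b) itself (bare mass `0⁻` is far above the chiral line, no crossed modes in fixed physical
volume) — that step is physics, not in the tree. -/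
theorem pin_window {Nf : ℕ} {reg : QCDRegularisation Nf} {m : Fin Nf → ℝ} {M₀ R : ℝ}
    (h : PinClause reg m M₀ R) {M : ℝ} (hM : M₀ < M) :
    ∀ᶠ k : ℕ in Filter.atTop,
      -8 ≤ reg.mcrit k - reg.a k * M / reg.Zm k ∧ reg.mcrit k - reg.a k * M / reg.Zm k ≤ 0 := by
  filter_upwards [h M hM] with k hk
  obtain ⟨S, hS⟩ := exists_admissible_S reg R k
  have hkS := hk S hS
  by_contra hcon
  have hμ : 0 < reg.mcrit k - reg.a k * M / reg.Zm k ∨ reg.mcrit k - reg.a k * M / reg.Zm k < -8 := by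
    rcases not_and_or.mp hcon with h1 | h1
    · exact Or.inr (lt_of_not_ge h1)
    · exact Or.inl (lt_of_not_ge h1)
  exact not_pin_at (reg.β k) hμ _ hkS


/-! ## § 2. Dirichlet-cell positivity at positive bare mass; the pin-less crux is trivially true

For EVERY principal submatrix (any predicate on site × colour × spin) of the `r = 1` Wilson–Dirac
matrix: its determinant is real (γ₅-hermiticity commutes with restriction since `Γ₅` is
diagonal — this is route item `DirichletDetReal`, proved here for all predicates) and strictly
positive for bare mass `μ > 0` (numerical range: `Re⟨x, (1 − cK)x⟩ ≥ (1 − 4c)‖x‖²` for the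
hopping `K = Σ W_ν` of four isometries, zero-extension of block kernel vectors, and the same
Neumann/IVT homotopy as § 1). Consequence: at a positive valence mass NO box is a sign defect
(`not_isSignDefect_of_pos`), so the crux with its pin clause deleted holds with `δ ≡ 0` along the
heavy junk regularisation `mcrit ≡ 1` (`withoutPin_holds`): the pin is the SOLE carrier of content.
-/

section CellPositivity

variable {L N : ℕ} [NeZero L] {G : Type*} [Group G] (ρ : G →* Matrix (Fin N) (Fin N) ℂ)

/-- The `γ₅` sign of a Wilson index: `+1` on the upper two spinor components, `−1` on the lower. -/
def g5sign (q : TorusSite 4 L × Fin N × Fin 4) : ℂ := (![1, 1, -1, -1] : Fin 4 → ℂ) q.2.2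

omit [NeZero L] in
theorem g5sign_mul_self (q : TorusSite 4 L × Fin N × Fin 4) : g5sign q * g5sign q = 1 := by
  obtain ⟨x, a, α⟩ := q
  unfold g5sign
  fin_cases α <;> simp

/-- **γ₅-hermiticity of every principal submatrix**: `(D|_p)ᴴ = Γ₅|_p · D|_p · Γ₅|_p`. -/
theorem block_conjTranspose (hρ : ∀ g, ρ g ∈ Matrix.unitaryGroup (Fin N) ℂ)
    (U : GaugeConfig 4 L G) (μ : ℝ) (p : TorusSite 4 L × Fin N × Fin 4 → Prop) [DecidablePred p] :
    (toSquareBlockProp (wilsonDirac ρ U μ 1) p)ᴴ =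
      diagonal (fun i : {a // p a} => g5sign i.1) * toSquareBlockProp (wilsonDirac ρ U μ 1) p *
        diagonal (fun i : {a // p a} => g5sign i.1) := by
  have hΓ := wilsonDirac_gammaFive_hermitian_holds (L := L) ρ hρ U μ 1
  rw [spinorLift_gammaFive_eq_diagonal] at hΓ
  ext i j
  have hij := congrFun (congrFun hΓ i.1) j.1
  rw [mul_diagonal, diagonal_mul, conjTranspose_apply] at hij
  rw [mul_diagonal, diagonal_mul, conjTranspose_apply]
  simp only [toSquareBlockProp_def, of_apply]
  rw [← hij]
  rfl

/-- **Route item `DirichletDetReal`, for every predicate**: principal-minor determinants of the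
Wilson–Dirac matrix are real. -/
theorem block_det_im (hρ : ∀ g, ρ g ∈ Matrix.unitaryGroup (Fin N) ℂ)
    (U : GaugeConfig 4 L G) (μ : ℝ) (p : TorusSite 4 L × Fin N × Fin 4 → Prop) [DecidablePred p] :
    (toSquareBlockProp (wilsonDirac ρ U μ 1) p).det.im = 0 := by
  set C := toSquareBlockProp (wilsonDirac ρ U μ 1) p
  have h := congrArg Matrix.det (block_conjTranspose ρ hρ U μ p)
  rw [det_conjTranspose, det_mul, det_mul, det_diagonal] at h
  have hprod : (∏ i : {a // p a}, g5sign i.1) * ∏ i : {a // p a}, g5sign i.1 = 1 := by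
    rw [← Finset.prod_mul_distrib]
    simp [g5sign_mul_self]
  have hfix : star C.det = C.det := by
    rw [h]
    calc (∏ i : {a // p a}, g5sign i.1) * C.det * ∏ i : {a // p a}, g5sign i.1
        = C.det * ((∏ i : {a // p a}, g5sign i.1) * ∏ i : {a // p a}, g5sign i.1) := by ring
      _ = C.det := by rw [hprod, mul_one]
  exact Complex.conj_eq_iff_im.mp hfix

omit [NeZero L] in
/-- `Re (x† x) ≥ 0`. -/
theorem re_star_dotProduct_self_nonneg {n : Type*} [Fintype n] (y : n → ℂ) :
    0 ≤ (star y ⬝ᵥ y).re := by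
  rw [dotProduct, Complex.re_sum]
  refine Finset.sum_nonneg fun i _ => ?_
  rw [Pi.star_apply, Complex.star_def, mul_comm, Complex.mul_conj, Complex.ofReal_re]
  exact Complex.normSq_nonneg _

omit [NeZero L] in
/-- `Re (x† x) > 0` for `x ≠ 0`. -/
theorem re_star_dotProduct_self_pos {n : Type*} [Fintype n] {y : n → ℂ} (hy : y ≠ 0) :
    0 < (star y ⬝ᵥ y).re := by
  rw [dotProduct, Complex.re_sum]
  obtain ⟨i, hi⟩ : ∃ i, y i ≠ 0 := Function.ne_iff.mp hy
  refine Finset.sum_pos' (fun j _ => ?_) ⟨i, Finset.mem_univ _, ?_⟩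
  · rw [Pi.star_apply, Complex.star_def, mul_comm, Complex.mul_conj, Complex.ofReal_re]
    exact Complex.normSq_nonneg _
  · rw [Pi.star_apply, Complex.star_def, mul_comm, Complex.mul_conj, Complex.ofReal_re]
    exact Complex.normSq_pos.mpr hi

omit [NeZero L] in
/-- For an isometry `W` (`Wᴴ W = 1`): `Re (x† W x) ≤ x† x` (expand `‖Wx − x‖² ≥ 0`). -/
theorem re_star_dotProduct_isometry_le {n : Type*} [Fintype n] [DecidableEq n]
    (W : Matrix n n ℂ) (hW : Wᴴ * W = 1) (x : n → ℂ) :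
    (star x ⬝ᵥ (W *ᵥ x)).re ≤ (star x ⬝ᵥ x).re := by
  have h0 := re_star_dotProduct_self_nonneg (W *ᵥ x - x)
  have h1 : star (W *ᵥ x) ⬝ᵥ (W *ᵥ x) = star x ⬝ᵥ x := by
    rw [star_mulVec, ← dotProduct_mulVec, mulVec_mulVec, hW, one_mulVec]
  have h2 : star (W *ᵥ x) ⬝ᵥ x = star (star x ⬝ᵥ (W *ᵥ x)) := by
    rw [star_dotProduct]
  have hexp : star (W *ᵥ x - x) ⬝ᵥ (W *ᵥ x - x) =
      star x ⬝ᵥ x - star (star x ⬝ᵥ (W *ᵥ x)) - star x ⬝ᵥ (W *ᵥ x) + star x ⬝ᵥ x := by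
    rw [star_sub, sub_dotProduct, dotProduct_sub, dotProduct_sub, h1, h2]
    ring
  rw [hexp] at h0
  simp only [Complex.add_re, Complex.sub_re, Complex.star_def, Complex.conj_re] at h0
  linarith

/-- **Numerical range of the hopping homotopy**: for `c ≥ 0`,
`Re (x† (1 − cK) x) ≥ (1 − 4c) · x† x`, `K = Σ_ν W_ν` the Wilson hopping (four isometries). -/
theorem re_form_segMatrix_ge (hρ : ∀ g, ρ g ∈ Matrix.unitaryGroup (Fin N) ℂ)
    (U : GaugeConfig 4 L G) (x : TorusSite 4 L × Fin N × Fin 4 → ℂ) {c : ℝ} (hc : 0 ≤ c) :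
    (1 - 4 * c) * (star x ⬝ᵥ x).re ≤
      (star x ⬝ᵥ ((1 - (c : ℂ) • ∑ ν, wilsonHop ρ U ν) *ᵥ x)).re := by
  have hsum : (∑ ν, wilsonHop ρ U ν) *ᵥ x = ∑ ν, wilsonHop ρ U ν *ᵥ x := Matrix.sum_mulVec _ _ _
  have hform : star x ⬝ᵥ ((1 - (c : ℂ) • ∑ ν, wilsonHop ρ U ν) *ᵥ x) =
      star x ⬝ᵥ x - (c : ℂ) * ∑ ν, star x ⬝ᵥ (wilsonHop ρ U ν *ᵥ x) := by
    rw [sub_mulVec, one_mulVec, smul_mulVec, hsum, dotProduct_sub, dotProduct_smul,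
      dotProduct_sum, smul_eq_mul]
  rw [hform, Complex.sub_re, Complex.re_ofReal_mul, Complex.re_sum]
  have hb : ∑ ν : Fin 4, (star x ⬝ᵥ (wilsonHop ρ U ν *ᵥ x)).re ≤ ∑ _ν : Fin 4, (star x ⬝ᵥ x).re :=
    Finset.sum_le_sum fun ν _ =>
      re_star_dotProduct_isometry_le _ (conjTranspose_mul_wilsonHop ρ hρ U ν) x
  have h4 : ∑ _ν : Fin 4, (star x ⬝ᵥ x).re = 4 * (star x ⬝ᵥ x).re := by simp [Finset.sum_const]
  rw [h4] at hb
  nlinarith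

omit [NeZero L] in
/-- Zero-extension of a block vector: the quadratic form of a principal submatrix is the
quadratic form of the full matrix on the extension, and the norms agree. -/
theorem block_form_eq_extend {n : Type*} [Fintype n] (A : Matrix n n ℂ) (p : n → Prop)
    [DecidablePred p] (v : {a // p a} → ℂ) :
    let x : n → ℂ := fun i => if h : p i then v ⟨i, h⟩ else 0
    star v ⬝ᵥ (toSquareBlockProp A p *ᵥ v) = star x ⬝ᵥ (A *ᵥ x) ∧
      star v ⬝ᵥ v = star x ⬝ᵥ x := by
  intro x
  have hx : ∀ i : {a // p a}, x i.1 = v i := fun i => by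
    simp only [x, dif_pos i.2]
  have hx' : ∀ i : {a // ¬ p a}, x i.1 = 0 := fun i => by
    simp only [x, dif_neg i.2]
  have hAx : ∀ i : n, (A *ᵥ x) i = ∑ j : {a // p a}, A i j.1 * v j := by
    intro i
    rw [mulVec, dotProduct, ← Fintype.sum_subtype_add_sum_subtype p (fun j => A i j * x j)]
    simp [hx, hx']
  constructor
  · rw [dotProduct, dotProduct, ← Fintype.sum_subtype_add_sum_subtype p (fun i => star x i * (A *ᵥ x) i)]
    simp only [Pi.star_apply, hx, hx', star_zero, zero_mul, Finset.sum_const_zero, add_zero, hAx]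
    rfl
  · rw [dotProduct, dotProduct, ← Fintype.sum_subtype_add_sum_subtype p (fun i => star x i * x i)]
    simp only [Pi.star_apply, hx, hx', star_zero, zero_mul, Finset.sum_const_zero, add_zero]

/-- The hopping homotopy restricted to a block is injective for `0 ≤ c < 1/4`, hence has non-zero
determinant. -/
theorem block_segMatrix_det_ne_zero (hρ : ∀ g, ρ g ∈ Matrix.unitaryGroup (Fin N) ℂ)
    (U : GaugeConfig 4 L G) (p : TorusSite 4 L × Fin N × Fin 4 → Prop) [DecidablePred p]
    {c : ℝ} (hc : 0 ≤ c) (hc4 : 4 * c < 1) :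
    (toSquareBlockProp (1 - (c : ℂ) • ∑ ν, wilsonHop ρ U ν) p).det ≠ 0 := by
  intro hdet
  obtain ⟨v, hv, hAv⟩ := Matrix.exists_mulVec_eq_zero_iff.mpr hdet
  obtain ⟨hform, -⟩ := block_form_eq_extend (1 - (c : ℂ) • ∑ ν, wilsonHop ρ U ν) p v
  set x : TorusSite 4 L × Fin N × Fin 4 → ℂ := fun i => if h : p i then v ⟨i, h⟩ else 0 with hxdef
  have hxne : x ≠ 0 := by
    intro hx0
    apply hv
    funext i
    have := congrFun hx0 i.1
    simp only [hxdef, dif_pos i.2, Pi.zero_apply] at this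
    exact this
  have hpos := re_star_dotProduct_self_pos hxne
  have hge := re_form_segMatrix_ge ρ hρ U x hc
  rw [← hform, hAv, dotProduct_zero, Complex.zero_re] at hge
  nlinarith

omit [NeZero L] in
/-- Restriction to a block commutes with scalars. -/
theorem toSquareBlockProp_smul {n : Type*} (c : ℂ) (M : Matrix n n ℂ) (p : n → Prop) :
    toSquareBlockProp (c • M) p = c • toSquareBlockProp M p := rfl

omit [NeZero L] in
/-- Restriction of the identity matrix to a block is the identity. -/
theorem toSquareBlockProp_one {n : Type*} [Fintype n] [DecidableEq n] (p : n → Prop) :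
    toSquareBlockProp (1 : Matrix n n ℂ) p = 1 :=
  submatrix_one _ Subtype.val_injective

/-- **Seiler positivity for Dirichlet cells / every principal submatrix**: for bare mass `μ > 0`,
`Re det (D_W(U, μ, 1)|_p) > 0` (and the determinant is real, `block_det_im`). -/
theorem block_det_re_pos (hρ : ∀ g, ρ g ∈ Matrix.unitaryGroup (Fin N) ℂ)
    (U : GaugeConfig 4 L G) {μ : ℝ} (hμ : 0 < μ) (p : TorusSite 4 L × Fin N × Fin 4 → Prop)
    [DecidablePred p] :
    0 < (toSquareBlockProp (wilsonDirac ρ U μ 1) p).det.re := by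
  have hμ4 : 0 < μ + 4 := by linarith
  have hμ0 : μ + 4 ≠ 0 := hμ4.ne'
  -- the homotopy on the block
  set g : ℝ → ℝ := fun t =>
    ((toSquareBlockProp (1 - ((t / (μ + 4) : ℝ) : ℂ) • ∑ ν, wilsonHop ρ U ν) p).det).re with hgdef
  have hg : Continuous g := by
    refine Complex.continuous_re.comp ?_
    refine Continuous.matrix_det ?_
    exact (continuous_const.sub
      ((Complex.continuous_ofReal.comp (continuous_id.div_const (μ + 4))).smul
        continuous_const)).matrix_submatrix _ _
  have hg0 : g 0 = 1 := by
    simp [hgdef, toSquareBlockProp_one]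
  -- reality along the path
  have him : ∀ t : ℝ, 0 ≤ t →
      ((toSquareBlockProp (1 - ((t / (μ + 4) : ℝ) : ℂ) • ∑ ν, wilsonHop ρ U ν) p).det).im = 0 := by
    intro t ht0
    rcases ht0.eq_or_lt with h | ht
    · subst h; simp [toSquareBlockProp_one]
    · rw [segMatrix_eq_smul_wilsonDirac_ne ρ hρ U hμ0 ht, toSquareBlockProp, toBlock,
        submatrix_smul, Pi.smul_apply, Pi.smul_apply, det_smul]
      have hreal := block_det_im ρ hρ U ((μ + 4) / t - 4) p
      rw [toSquareBlockProp, toBlock] at hreal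
      set d := ((wilsonDirac ρ U ((μ + 4) / t - 4) 1).submatrix Subtype.val Subtype.val :
        Matrix {a // p a} {a // p a} ℂ).det with hd
      have hd' : d = ((d.re : ℝ) : ℂ) := Complex.ext (by simp) (by simpa using hreal)
      rw [hd', ← Complex.ofReal_pow, ← Complex.ofReal_mul, Complex.ofReal_im]
  have hne : ∀ t ∈ Set.Icc (0 : ℝ) 1, g t ≠ 0 := by
    intro t ht h0
    have hc : 0 ≤ t / (μ + 4) := div_nonneg ht.1 hμ4.le
    have hc4 : 4 * (t / (μ + 4)) < 1 := by
      rw [mul_div_assoc', div_lt_one hμ4]; linarith [ht.2]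
    apply block_segMatrix_det_ne_zero ρ hρ U p hc hc4
    exact Complex.ext (by simpa [hgdef] using h0) (by simpa using him t ht.1)
  have hg1 : 0 < g 1 := by
    refine lt_of_not_ge fun hle => ?_
    have hmem : (0 : ℝ) ∈ Set.Icc (g 1) (g 0) := ⟨hle, by rw [hg0]; norm_num⟩
    obtain ⟨t, ht, ht0⟩ := intermediate_value_Icc' zero_le_one hg.continuousOn hmem
    exact hne t ht ht0
  have hD : toSquareBlockProp (wilsonDirac ρ U μ 1) p =
      ((μ + 4 : ℝ) : ℂ) • toSquareBlockProp (1 - ((1 / (μ + 4) : ℝ) : ℂ) • ∑ ν, wilsonHop ρ U ν) p := by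
    rw [← toSquareBlockProp_smul, smul_sub, smul_smul,
      ← Complex.ofReal_mul, show (μ + 4) * (1 / (μ + 4)) = 1 by field_simp, Complex.ofReal_one,
      one_smul, wilsonDirac_eq_sub_sum_wilsonHop ρ hρ]
  have hdet : (toSquareBlockProp (wilsonDirac ρ U μ 1) p).det =
      (((μ + 4) ^ Fintype.card {a // p a} * g 1 : ℝ) : ℂ) := by
    rw [hD, det_smul]
    have him1 := him 1 zero_le_one
    set d := (toSquareBlockProp (1 - ((1 / (μ + 4) : ℝ) : ℂ) • ∑ ν, wilsonHop ρ U ν) p).det with hd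
    have hd' : d = ((d.re : ℝ) : ℂ) := Complex.ext (by simp) (by simpa using him1)
    rw [hd', ← Complex.ofReal_pow, ← Complex.ofReal_mul]
  rw [hdet, Complex.ofReal_re]
  exact mul_pos (pow_pos hμ4 _) hg1

end CellPositivity

/-! ### Consequences for the crux vocabulary -/

/-- At positive bare mass every Dirichlet cell determinant is positive. -/
theorem cellDetRe_pos {N : ℕ} [NeZero N] (U : GaugeConfig 4 N 𝔾) {μ : ℝ} (hμ : 0 < μ)
    (x : TorusSite 4 N) (s : Fin 4 → ℕ) : 0 < cellDetRe U μ x s :=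
  block_det_re_pos (fundamentalRep (Fin 3)) fund_unitary U hμ (wilsonBox x s)

/-- Hence NO box is a sign defect at a positive valence mass (any scale `j`). -/
theorem not_isSignDefect_of_pos {N : ℕ} [NeZero N] (U : GaugeConfig 4 N 𝔾) {μ : ℝ} (hμ : 0 < μ)
    (j : ℕ) (s : Fin 4 → ℕ) : ¬ IsSignDefect U μ j s := by
  rintro (⟨-, h⟩ | ⟨-, h⟩)
  · exact absurd h (not_lt.mpr (cellDetRe_pos U hμ 0 s).le)
  · have hp : 0 < cellDetRe U μ 0 s * ∏ ε : Fin 4 → Bool, cellDetRe U μ (halfCorner s ε) (halfSides s ε) :=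
      mul_pos (cellDetRe_pos U hμ 0 s) (Finset.prod_pos fun ε _ => cellDetRe_pos U hμ _ _)
    exact absurd h (not_lt.mpr hp.le)

/-! ### The pin-less crux holds trivially -/

section WithoutPin

open scoped Classical

/-- `NegativeCellsDilute` with its pin clause (b) DELETED, everything else verbatim. -/
def NegativeCellsDiluteWithoutPin : Prop :=
  ∀ Nf : ℕ, (Nf = 2 ∨ Nf = 3) → ∃ reg : QCDRegularisation Nf, reg.HasMassScaling ∧ (reg.scheme 0 0 0).HasAsymptoticScaling ∧ ∃ M₀ : ℝ, 0 ≤ M₀ ∧ ∃ b₀ : ℕ, 2 ≤ b₀ ∧ ∃ ℓ : ℝ, 0 < ℓ ∧ ∀ m : Fin Nf → ℝ, (∀ f, M₀ < m f) → ∃ R : ℝ, 0 < R ∧ (∀ ε : ℝ, 0 < ε → ∀ᶠ k : ℕ in Filter.atTop, ∀ S : ℕ, R ≤ reg.a k * (2 * S + 1) → let N : ℕ := 2 * S + 1; let mq : Fin Nf → ℝ := fun f => reg.mcrit k + reg.a k * m f / reg.Zm k; let wt : GaugeConfig 4 N (Matrix.specialUnitaryGroup (Fin 3) ℂ) → ℝ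 := fun U => ∏ f, ‖fermionDet (wilsonDirac (fundamentalRep (Fin 3)) U (mq f) 1)‖; let P : (GaugeConfig 4 N (Matrix.specialUnitaryGroup (Fin 3) ℂ) → Prop) → ℝ := fun E => (∫ U, (if E U then (1 : ℝ) else 0) * wt U ∂(wilsonMeasure (d := 4) (L := N) (fundamentalRep (Fin 3)) (reg.β k))) / (∫ U, wt U ∂(wilsonMeasure (d := 4) (L := N) (fundamentalRep (Fin 3)) (reg.β k))); let J : ℕ := Nat.log 2 (⌊ℓ / reg.a k⌋₊ / b₀) + 1; ∃ δ : ℕ → ℝ, ∑ j ∈ Finset.range J, δ j ≤ ε ∧ ∀ j < J, ∀ s : Fin 4 → ℕ, (∀ i, b₀ * 2 ^ j ≤ s i ∧ s i < b₀ * 2 ^ (j + 2) ∧ s i ≤ N ∧ (s i : ℝ) * reg.a k ≤ ℓ) → P (fun U => ∃ f, IsSignDefect U (mq f) j s) ≤ δ j)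

/-- The crux implies its pin-less version (projection; certifies the text is verbatim). -/
theorem withoutPin_of_crux (h : Theses.NestedDissectionSea.NegativeCellsDilute) :
    NegativeCellsDiluteWithoutPin := by
  intro Nf hNf
  obtain ⟨reg, h1, h2, M₀, hM₀, b₀, hb₀, ℓ, hℓ, h⟩ := h Nf hNf
  refine ⟨reg, h1, h2, M₀, hM₀, b₀, hb₀, ℓ, hℓ, fun m hm => ?_⟩
  obtain ⟨R, hR, ha, -⟩ := h m hm
  exact ⟨R, hR, ha⟩

/-- The HEAVY junk regularisation: `canonicalAF` (`a_k = 1/(k+1)`, two-loop `β_k`, canonical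
`Z_m`) with `m_crit ≡ 1` — every valence mass is positive (`κ < 1/8`). -/
def heavyReg (Nf : ℕ) : QCDRegularisation Nf :=
  { QCDRegularisation.canonicalAF Nf with mcrit := fun _ => 1 }

theorem heavyReg_hasMassScaling (Nf : ℕ) : (heavyReg Nf).HasMassScaling :=
  QCDRegularisation.canonicalAF_hasMassScaling

theorem heavyReg_hasAsymptoticScaling (Nf : ℕ) : ((heavyReg Nf).scheme 0 0 0).HasAsymptoticScaling :=
  QCDScheme.zeroAF_hasAsymptoticScaling

/-- **Triviality of the pin-less crux.** With the pin deleted, `NegativeCellsDilute` holds by the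
heavy junk witness: all valence masses are `> 0`, no box is ever a sign defect
(`not_isSignDefect_of_pos`), `δ ≡ 0`. So clause (b) is the ONLY clause standing between the crux
and a junk proof, and every genuine proof must pass through the parity pin. -/
theorem withoutPin_holds : NegativeCellsDiluteWithoutPin := by
  intro Nf hNf
  refine ⟨heavyReg Nf, heavyReg_hasMassScaling Nf, heavyReg_hasAsymptoticScaling Nf, 0, le_rfl, 2,
    le_rfl, 1, one_pos, fun m hm => ⟨1, one_pos, ?_⟩⟩
  intro ε hε
  refine Filter.Eventually.of_forall fun k S _ => ?_
  intro N mq wt P J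
  refine ⟨fun _ => 0, by simp [hε.le], ?_⟩
  intro j _ s _
  have hpos : ∀ f, 0 < mq f := by
    intro f
    show 0 < (heavyReg Nf).mcrit k + (heavyReg Nf).a k * m f / (heavyReg Nf).Zm k
    have h1 : (heavyReg Nf).mcrit k = 1 := rfl
    have h2 : 0 ≤ (heavyReg Nf).a k * m f / (heavyReg Nf).Zm k :=
      div_nonneg (mul_nonneg ((heavyReg Nf).a_pos k).le (hm f).le) ((heavyReg Nf).Zm_pos k).le
    linarith
  have hE : ∀ U : GaugeConfig 4 N 𝔾, ¬ ∃ f, IsSignDefect U (mq f) j s :=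
    fun U ⟨f, hf⟩ => not_isSignDefect_of_pos U (hpos f) j s hf
  simp only [P]
  simp [hE]

end WithoutPin


/-! ## § 3. A natural strengthening refuted: the pin cannot hold uniformly in the depth `M`

Clause (b) reads `∀ M > M₀, ∀ᶠ k, …`: the step `k₀(M)` from which the pin holds may depend on the
depth `M`. The SWAPPED form `∀ᶠ k, ∀ M > M₀, …` is false for EVERY regularisation (no measure theory:
at a fixed step `k` a depth `M ≥ (mcrit k + 9) Z_m(k)/a_k` puts the probe below `−8`, where the pin
event is empty by mirror Seiler positivity, § 1). Physically, too, the uniform form is wrong: at fixed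
`k` a deep probe passes the doubler crossings. So `k₀` MUST grow with `M`; a proof of (b) has to say
how (physically `a_{k₀} M / Z_m ≪ |m_c(β_{k₀})|`, i.e. the probe must stay inside the physical branch).
-/

section UniformPin

open scoped Classical

/-- Clause (b) with the quantifiers `∀ M > M₀` and `∀ᶠ k` SWAPPED (uniformity in the depth `M`);
the body is verbatim. -/
def UniformPinClause {Nf : ℕ} (reg : QCDRegularisation Nf) (m : Fin Nf → ℝ) (M₀ R : ℝ) : Prop :=
  ∀ᶠ k : ℕ in Filter.atTop, ∀ M : ℝ, M₀ < M → ∀ S : ℕ, R ≤ reg.a k * (2 * S + 1) →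
    let N : ℕ := 2 * S + 1
    let mq : Fin Nf → ℝ := fun f => reg.mcrit k + reg.a k * m f / reg.Zm k
    let wt : GaugeConfig 4 N 𝔾 → ℝ :=
      fun U => ∏ f, ‖fermionDet (wilsonDirac (fundamentalRep (Fin 3)) U (mq f) 1)‖
    (1 / 4 : ℝ) ≤ (∫ U, (if (fermionDet (wilsonDirac (fundamentalRep (Fin 3)) U
        (reg.mcrit k - reg.a k * M / reg.Zm k) 1)).re < 0 then (1 : ℝ) else 0) * wt U
          ∂(wilsonMeasure (d := 4) (L := N) (fundamentalRep (Fin 3)) (reg.β k))) /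
      (∫ U, wt U ∂(wilsonMeasure (d := 4) (L := N) (fundamentalRep (Fin 3)) (reg.β k)))

/-- The uniform pin implies the pin: it IS a strengthening of clause (b). -/
theorem pinClause_of_uniform {Nf : ℕ} {reg : QCDRegularisation Nf} {m : Fin Nf → ℝ} {M₀ R : ℝ}
    (h : UniformPinClause reg m M₀ R) : PinClause reg m M₀ R := by
  intro M hM
  filter_upwards [h] with k hk
  exact hk M hM

/-- At a fixed step `k`, any depth `M ≥ (mcrit k + 9) Z_m(k) / a_k` puts the probe mass below `−8`. -/
theorem probe_lt_neg_eight {Nf : ℕ} (reg : QCDRegularisation Nf) (k : ℕ) {M : ℝ}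
    (hM : (reg.mcrit k + 9) * reg.Zm k / reg.a k ≤ M) :
    reg.mcrit k - reg.a k * M / reg.Zm k < -8 := by
  have ha := reg.a_pos k
  have hZ := reg.Zm_pos k
  rw [div_le_iff₀ ha] at hM
  have h1 : reg.mcrit k + 9 ≤ reg.a k * M / reg.Zm k := by
    rw [le_div_iff₀ hZ]
    linarith
  linarith

/-- **No uniform pin.** For EVERY regularisation, mass tuple, threshold and size the uniform-in-`M`
pin clause is false: at any step `k` of its eventual range the depth
`M = max (M₀ + 1) ((mcrit k + 9) Z_m(k)/a_k)` has probe mass `< −8`, an EMPTY pin event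
(`pinIndicator_eq_zero`, mirror Seiler positivity) and pin ratio `0 < 1/4`. The order of
quantifiers in clause (b) is load-bearing. -/
theorem not_uniformPinClause {Nf : ℕ} (reg : QCDRegularisation Nf) (m : Fin Nf → ℝ) (M₀ R : ℝ) :
    ¬ UniformPinClause reg m M₀ R := by
  intro h
  obtain ⟨k, hk⟩ := h.exists
  obtain ⟨S, hS⟩ := exists_admissible_S reg R k
  have hM₀ : M₀ < max (M₀ + 1) ((reg.mcrit k + 9) * reg.Zm k / reg.a k) :=
    lt_of_lt_of_le (lt_add_one M₀) (le_max_left _ _)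
  have hprobe : reg.mcrit k - reg.a k * max (M₀ + 1) ((reg.mcrit k + 9) * reg.Zm k / reg.a k) /
      reg.Zm k < -8 :=
    probe_lt_neg_eight reg k (le_max_right _ _)
  exact not_pin_at (reg.β k) (Or.inr hprobe) _ (hk _ hM₀ S hS)

/-- `NegativeCellsDilute` with clause (b) made UNIFORM in `M` (the quantifier swap), everything else
verbatim. -/
def NegativeCellsDiluteUniformPin : Prop :=
  ∀ Nf : ℕ, (Nf = 2 ∨ Nf = 3) → ∃ reg : QCDRegularisation Nf, reg.HasMassScaling ∧ (reg.scheme 0 0 0).HasAsymptoticScaling ∧ ∃ M₀ : ℝ, 0 ≤ M₀ ∧ ∃ b₀ : ℕ, 2 ≤ b₀ ∧ ∃ ℓ : ℝ, 0 < ℓ ∧ ∀ m : Fin Nf → ℝ, (∀ f, M₀ < m f) → ∃ R : ℝ, 0 < R ∧ (∀ ε : ℝ, 0 < ε → ∀ᶠ k : ℕ in Filter.atTop, ∀ S : ℕ, R ≤ reg.a k * (2 * S + 1) → let N : ℕ := 2 * S + 1; let mq : Fin Nf → ℝ := fun f => reg.mcrit k + reg.a k * m f / reg.Zm k; let wt :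 GaugeConfig 4 N (Matrix.specialUnitaryGroup (Fin 3) ℂ) → ℝ := fun U => ∏ f, ‖fermionDet (wilsonDirac (fundamentalRep (Fin 3)) U (mq f) 1)‖; let P : (GaugeConfig 4 N (Matrix.specialUnitaryGroup (Fin 3) ℂ) → Prop) → ℝ := fun E => (∫ U, (if E U then (1 : ℝ) else 0) * wt U ∂(wilsonMeasure (d := 4) (L := N) (fundamentalRep (Fin 3)) (reg.β k))) / (∫ U, wt U ∂(wilsonMeasure (d := 4) (L := N) (fundamentalRep (Fin 3)) (reg.β k))); let J : ℕ := Nat.log 2 (⌊ℓ / reg.a k⌋₊ / b₀) + 1; ∃ δ : ℕ → ℝ, ∑ j ∈ Finset.range J, δ j ≤ ε ∧ ∀ j < J, ∀ s : Fin 4 → ℕ, (∀ i, b₀ * 2 ^ j ≤ s i ∧ s i < b₀ * 2 ^ (j + 2) ∧ s i ≤ N ∧ (s i : ℝ) * reg.a k ≤ ℓ) → P (fun U => ∃ f, IsSignDefect U (mq f) j s) ≤ δ j) ∧ UniformPinClause reg m M₀ R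

/-- **The uniformly-pinned crux is false** (unconditionally, for every `Nf`-branch: instantiate
`Nf = 2`, `m ≡ M₀ + 1`, and apply `not_uniformPinClause`). -/
theorem not_negativeCellsDiluteUniformPin : ¬ NegativeCellsDiluteUniformPin := by
  intro h
  obtain ⟨reg, -, -, M₀, -, b₀, -, ℓ, -, h⟩ := h 2 (Or.inl rfl)
  obtain ⟨R, -, -, hb⟩ := h (fun _ => M₀ + 1) (fun _ => lt_add_one M₀)
  exact not_uniformPinClause reg _ M₀ R hb

end UniformPin

/-! ## § 4. The sandwich `HighLinePin → crux → Pin`: where the content sits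

§ 2 showed that clause (a) is junk-satisfiable whenever all valence masses are positive. Sharper:
the crux is IMPLIED by clause (b) alone along any admissible regularisation whose critical-mass
datum keeps the valence masses positive, `mcrit k ≥ −a_k M₀ / Z_m(k)` (`crux_of_highLinePin`), and
it IMPLIES clause (b) (`pinClause_of_crux`, § 1). So the whole content of `NegativeCellsDilute`
beyond the bare pin is the assertion that NO such high line carries the pin — physics, not in the
tree: on a high line the probe `−a_k(M + M₀)/Z_m(k) → 0⁻` sits `|m_c(β_k)| ≍ 0.43 g₀² ≫ a_k M/Z_m`
ABOVE the chiral line, a real eigenvalue of `K_U` within `a_k M/Z_m` of the spectral edge `4` is a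
Lifshitz-tail event (a nearly pure-gauge region of `≳ (Z_m/(a_k M))²` sites), and
`P(Re det < 0) → 0` on every torus of physical side `≥ R` (small-torus numerics of the near-edge
real eigenvalues of `K_U` for near-identity links: kit j010655, see § 7 when folded in). A reviewer of any claimed proof of the crux
must therefore check WHICH line it uses: a proof along a high line would be a proof of
`HighLinePin`, a (false) statement about near-edge real modes of almost-free Wilson operators, not
about chiral physics; an honest proof has `mcrit k ≈ m_c(β_k) < 0` with NEGATIVE valence masses,
where (a) is the early-crosser law.
-/

section Sandwich

open scoped Classical

/-- **High-line pin**: the admissibility constraints, a threshold `M₀`, a critical-mass datum with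
`mcrit k ≥ −a_k M₀/Z_m(k)` for all `k` (so that every valence mass `mcrit k + a_k m_f/Z_m(k)`,
`m_f > M₀`, is positive), and clause (b) verbatim. -/
def HighLinePin : Prop :=
  ∀ Nf : ℕ, (Nf = 2 ∨ Nf = 3) → ∃ reg : QCDRegularisation Nf, reg.HasMassScaling ∧
    (reg.scheme 0 0 0).HasAsymptoticScaling ∧ ∃ M₀ : ℝ, 0 ≤ M₀ ∧
    (∀ k, -(reg.a k * M₀ / reg.Zm k) ≤ reg.mcrit k) ∧
    ∀ m : Fin Nf → ℝ, (∀ f, M₀ < m f) → ∃ R : ℝ, 0 < R ∧ PinClause reg m M₀ R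

/-- **`HighLinePin → NegativeCellsDilute`.** Along a high line clause (a) holds with `δ ≡ 0`
(`not_isSignDefect_of_pos`: no sign defect at a positive valence mass, any box, any scale, any
field), with `b₀ = 2`, `ℓ = 1`; clause (b) is carried over verbatim. -/
theorem crux_of_highLinePin (h : HighLinePin) : Theses.NestedDissectionSea.NegativeCellsDilute := by
  intro Nf hNf
  obtain ⟨reg, hms, has, M₀, hM₀, hline, h⟩ := h Nf hNf
  refine ⟨reg, hms, has, M₀, hM₀, 2, le_rfl, 1, one_pos, fun m hm => ?_⟩
  obtain ⟨R, hR, hpin⟩ := h m hm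
  refine ⟨R, hR, ?_, hpin⟩
  intro ε hε
  refine Filter.Eventually.of_forall fun k S _ => ?_
  intro N mq wt P J
  refine ⟨fun _ => 0, by simp [hε.le], ?_⟩
  intro j _ s _
  have hpos : ∀ f, 0 < mq f := by
    intro f
    show 0 < reg.mcrit k + reg.a k * m f / reg.Zm k
    have h1 := hline k
    have h2 : reg.a k * M₀ / reg.Zm k < reg.a k * m f / reg.Zm k :=
      div_lt_div_of_pos_right (mul_lt_mul_of_pos_left (hm f) (reg.a_pos k)) (reg.Zm_pos k)
    linarith
  have hE : ∀ U : GaugeConfig 4 N 𝔾, ¬ ∃ f, IsSignDefect U (mq f) j s :=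
    fun U ⟨f, hf⟩ => not_isSignDefect_of_pos U (hpos f) j s hf
  simp only [P]
  simp [hE]

/-- The sandwich in one line: `HighLinePin → crux` and `crux → (∃ admissible reg, M₀, ∀ m ∃ R, Pin)`. -/
theorem crux_sandwich :
    (HighLinePin → Theses.NestedDissectionSea.NegativeCellsDilute) ∧
    (Theses.NestedDissectionSea.NegativeCellsDilute →
      ∀ Nf : ℕ, (Nf = 2 ∨ Nf = 3) → ∃ reg : QCDRegularisation Nf, ∃ M₀ : ℝ, 0 ≤ M₀ ∧
        ∀ m : Fin Nf → ℝ, (∀ f, M₀ < m f) → ∃ R : ℝ, 0 < R ∧ PinClause reg m M₀ R) :=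
  ⟨crux_of_highLinePin, pinClause_of_crux⟩

end Sandwich

/-! ## § 5. The pin drives the critical-mass datum to `(−∞, 0]`

Quantitative form of § 1 for admissible regularisations: `HasMassScaling` makes `Z_m(k) → ∞`
(`RobustYangMillsHandover.Negative.tendsto_massIncrement_zero`, landed by a sibling disprover), so
the window `mcrit k ≤ a_k M/Z_m(k)` closes: every witness of clause (b) has `mcrit k < η`
eventually, for every `η > 0` (`limsup mcrit ≤ 0`). Combined with § 4: the only lines left are
`mcrit k → 0⁻` from above the chiral line (high lines, physics-false) or at/below it.
-/

section McritAsymptotics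

/-- **`limsup mcrit ≤ 0` for pinned admissible regularisations** (`Nf ≤ 16`, `HasMassScaling`,
clause (b)): for every `η > 0`, eventually `mcrit k < η`. -/
theorem mcrit_eventually_lt {Nf : ℕ} (hNf : Nf ≤ 16) {reg : QCDRegularisation Nf}
    (hms : reg.HasMassScaling) {m : Fin Nf → ℝ} {M₀ R : ℝ} (h : PinClause reg m M₀ R)
    {η : ℝ} (hη : 0 < η) : ∀ᶠ k : ℕ in Filter.atTop, reg.mcrit k < η := by
  have h1 := pin_window h (lt_add_one M₀)
  have h2 := Theorems.RobustYangMillsHandover.Negative.tendsto_massIncrement_zero hNf reg hms (M₀ + 1)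
  filter_upwards [h1, (tendsto_order.mp h2).2 η hη] with k hk hk'
  linarith [hk.2]

/-- Crux-level reading: any witness `reg` of `NegativeCellsDilute` has `mcrit k < η` eventually for
every `η > 0` (and `mcrit k ≥ −8 − o(1)`, § 1). -/
theorem mcrit_eventually_lt_of_crux (h : Theses.NestedDissectionSea.NegativeCellsDilute) :
    ∀ Nf : ℕ, (Nf = 2 ∨ Nf = 3) → ∃ reg : QCDRegularisation Nf, reg.HasMassScaling ∧
      (reg.scheme 0 0 0).HasAsymptoticScaling ∧ (∀ η : ℝ, 0 < η → ∀ᶠ k : ℕ in Filter.atTop,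
        reg.mcrit k < η) ∧ ∃ M₀ : ℝ, 0 ≤ M₀ ∧ ∀ m : Fin Nf → ℝ, (∀ f, M₀ < m f) →
          ∃ R : ℝ, 0 < R ∧ PinClause reg m M₀ R := by
  intro Nf hNf
  have hNf16 : Nf ≤ 16 := by rcases hNf with rfl | rfl <;> norm_num
  obtain ⟨reg, hms, has, M₀, hM₀, b₀, -, ℓ, -, h⟩ := h Nf hNf
  have hpin : ∀ m : Fin Nf → ℝ, (∀ f, M₀ < m f) → ∃ R : ℝ, 0 < R ∧ PinClause reg m M₀ R := by
    intro m hm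
    obtain ⟨R, hR, -, hb⟩ := h m hm
    exact ⟨R, hR, hb⟩
  refine ⟨reg, hms, has, fun η hη => ?_, M₀, hM₀, hpin⟩
  obtain ⟨R, -, hb⟩ := hpin (fun _ => M₀ + 1) (fun _ => lt_add_one M₀)
  exact mcrit_eventually_lt hNf16 hms hb hη

end McritAsymptotics


/-! ## § 6. What the pin event and a sign defect FORCE: crossings above the mass

Route item `SignDefectForcesCrossing` (stmt-QuantumFields-13898) is PROVED here
(`signDefectForcesCrossing`, verbatim; candidate proof attached to that item as `Crossing.lean`),
together with its whole-torus analogue for the pin: `Re det D_W(U, μ, 1) < 0` forces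
`det D_W(U, μ', 1) = 0` for some `μ' ∈ (μ, 0]` (`exists_fermionDet_eq_zero_of_re_neg`). So the pin
event of clause (b) is a CROSSING event — a proof of (b) must produce, with phase-quenched
probability `≥ 1/4` on every odd torus of physical side `≥ R`, eventually in `k`, gauge fields
whose hopping matrix `K_U` has a real eigenvalue in `(probe + 4, 4]`, `probe = mcrit k − a_k M/Z_m k`
(an odd number of them with multiplicity); and a disproof must show such fields have probability
`< 1/4` for EVERY admissible `reg` — on the honest line these are the physical index modes.
-/

section Crossing

variable {L N : ℕ} [NeZero L] {G : Type*} [Group G] (ρ : G →* Matrix (Fin N) (Fin N) ℂ)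

omit [NeZero L] in
/-- The mass enters the Wilson–Dirac matrix as `+ t • 1` (from `D_W = (m+4)·1 − Σ_ν W_ν`). -/
theorem wilsonDirac_eq_add_smul_one (hρ : ∀ g, ρ g ∈ Matrix.unitaryGroup (Fin N) ℂ)
    (U : GaugeConfig 4 L G) (t : ℝ) :
    wilsonDirac ρ U t 1 = wilsonDirac ρ U 0 1 + ((t : ℂ)) • (1 : Matrix _ _ ℂ) := by
  rw [wilsonDirac_eq_sub_sum_wilsonHop ρ hρ, wilsonDirac_eq_sub_sum_wilsonHop ρ hρ,
    show ((t + 4 : ℝ) : ℂ) = ((0 + 4 : ℝ) : ℂ) + (t : ℂ) by push_cast; ring, add_smul]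
  abel

omit [NeZero L] in
/-- `t ↦ D_W(U, t, 1)` is continuous (affine). -/
theorem continuous_wilsonDirac_mass (hρ : ∀ g, ρ g ∈ Matrix.unitaryGroup (Fin N) ℂ)
    (U : GaugeConfig 4 L G) :
    Continuous fun t : ℝ => wilsonDirac ρ U t 1 := by
  have h : (fun t : ℝ => wilsonDirac ρ U t 1) =
      fun t : ℝ => wilsonDirac ρ U 0 1 + ((t : ℂ)) • (1 : Matrix _ _ ℂ) := by
    funext t; exact wilsonDirac_eq_add_smul_one ρ hρ U t
  rw [h]
  exact continuous_const.add (Complex.continuous_ofReal.smul continuous_const)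

/-- `t ↦ det (D_W(U, t, 1)|_p)` is continuous, for every principal block `p`. -/
theorem continuous_blockDet_mass (hρ : ∀ g, ρ g ∈ Matrix.unitaryGroup (Fin N) ℂ)
    (U : GaugeConfig 4 L G)
    (p : TorusSite 4 L × Fin N × Fin 4 → Prop) [DecidablePred p] :
    Continuous fun t : ℝ => (toSquareBlockProp (wilsonDirac ρ U t 1) p).det := by
  have h : Continuous fun t : ℝ => toSquareBlockProp (wilsonDirac ρ U t 1) p :=
    (continuous_wilsonDirac_mass ρ hρ U).matrix_submatrix _ _
  exact h.matrix_det

/-- **A negative principal minor forces a singular block at a larger mass.** If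
`Re det (D_W(U, μ, 1)|_p) < 0` then `det (D_W(U, μ', 1)|_p) = 0` for some `μ' ∈ (μ, 1)`: the minor
is real (`block_det_im`), continuous in the mass, and positive at mass `1` (`block_det_re_pos`);
intermediate value theorem. -/
theorem exists_blockDet_eq_zero_of_re_neg (hρ : ∀ g, ρ g ∈ Matrix.unitaryGroup (Fin N) ℂ)
    (U : GaugeConfig 4 L G) {μ : ℝ} (p : TorusSite 4 L × Fin N × Fin 4 → Prop) [DecidablePred p]
    (hneg : (toSquareBlockProp (wilsonDirac ρ U μ 1) p).det.re < 0) :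
    ∃ μ' : ℝ, μ < μ' ∧ μ' < 1 ∧ (toSquareBlockProp (wilsonDirac ρ U μ' 1) p).det = 0 := by
  set g : ℝ → ℝ := fun t => (toSquareBlockProp (wilsonDirac ρ U t 1) p).det.re with hgdef
  have hg : Continuous g := Complex.continuous_re.comp (continuous_blockDet_mass ρ hρ U p)
  have hμ1 : μ < 1 := by
    by_contra h
    have hpos := block_det_re_pos ρ hρ U (lt_of_lt_of_le one_pos (not_lt.mp h)) p
    exact absurd hneg (not_lt.mpr hpos.le)
  have hg1 : 0 < g 1 := block_det_re_pos ρ hρ U one_pos p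
  have hmem : (0 : ℝ) ∈ Set.Ioo (g μ) (g 1) := ⟨hneg, hg1⟩
  obtain ⟨t, ht, ht0⟩ := intermediate_value_Ioo hμ1.le hg.continuousOn hmem
  refine ⟨t, ht.1, ht.2, ?_⟩
  exact Complex.ext (by simpa [hgdef] using ht0) (by simpa using block_det_im ρ hρ U t p)

/-- **A negative Wilson determinant forces a crossing above the mass** (torus version): if
`Re det D_W(U, μ, 1) < 0` then `det D_W(U, μ', 1) = 0` for some `μ' ∈ (μ, 0]` — a real
eigenvalue of `K_U` lies in `(μ + 4, 4]` (`≤ 0` by Seiler positivity). -/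
theorem exists_fermionDet_eq_zero_of_re_neg (hρ : ∀ g, ρ g ∈ Matrix.unitaryGroup (Fin N) ℂ)
    (U : GaugeConfig 4 L G) {μ : ℝ} (hneg : (fermionDet (wilsonDirac ρ U μ 1)).re < 0) :
    ∃ μ' : ℝ, μ < μ' ∧ μ' ≤ 0 ∧ fermionDet (wilsonDirac ρ U μ' 1) = 0 := by
  have key : ∀ t : ℝ, (toSquareBlockProp (wilsonDirac ρ U t 1) (fun _ => True)).det =
      fermionDet (wilsonDirac ρ U t 1) := by
    intro t
    rw [fermionDet, toSquareBlockProp, toBlock]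
    exact Matrix.det_submatrix_equiv_self (Equiv.subtypeUnivEquiv fun _ => trivial) _
  have hneg' : (toSquareBlockProp (wilsonDirac ρ U μ 1) (fun _ => True)).det.re < 0 := by
    rw [key]; exact hneg
  obtain ⟨μ', h1, -, h0⟩ := exists_blockDet_eq_zero_of_re_neg ρ hρ U (fun _ => True) hneg'
  rw [key] at h0
  refine ⟨μ', h1, ?_, h0⟩
  by_contra hpos
  have := fermionDet_wilsonDirac_re_pos ρ hρ U (lt_of_not_ge hpos)
  rw [h0] at this
  simp at this

end Crossing

/-- A negative product of reals has a negative factor: either the head or one in the product. -/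
theorem neg_factor_of_mul_prod_neg {ι : Type*} [Fintype ι] {a : ℝ} {f : ι → ℝ}
    (h : a * ∏ i, f i < 0) : a < 0 ∨ ∃ i, f i < 0 := by
  rcases lt_or_ge a 0 with ha | ha
  · exact Or.inl ha
  · right
    by_contra hcon
    have hf : ∀ i, 0 ≤ f i := fun i => not_lt.mp fun hi => hcon ⟨i, hi⟩
    exact absurd h (not_lt.mpr (mul_nonneg ha (Finset.prod_nonneg fun i _ => hf i)))

/-- **Route item `SignDefectForcesCrossing` (stmt-QuantumFields-13898) holds**, verbatim: a sign
defect of the corner-`0` box of sides `s` at bare mass `μ`, any scale `j`, forces a zero mode of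
the parent or of a child Dirichlet cell at some `μ' ≥ μ` (indeed `μ' ∈ (μ, 1)`). -/
theorem signDefectForcesCrossing : Theses.NestedDissectionSea.SignDefectForcesCrossing := by
  intro N _ U μ j s hdef
  rcases hdef with ⟨-, hneg⟩ | ⟨-, hneg⟩
  · obtain ⟨μ', h1, -, h0⟩ :=
      exists_blockDet_eq_zero_of_re_neg (fundamentalRep (Fin 3)) fund_unitary U (wilsonBox 0 s) hneg
    exact ⟨μ', h1.le, Or.inl h0⟩
  · rcases neg_factor_of_mul_prod_neg hneg with hpar | ⟨ε, hch⟩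
    · obtain ⟨μ', h1, -, h0⟩ :=
        exists_blockDet_eq_zero_of_re_neg (fundamentalRep (Fin 3)) fund_unitary U (wilsonBox 0 s) hpar
      exact ⟨μ', h1.le, Or.inl h0⟩
    · obtain ⟨μ', h1, -, h0⟩ :=
        exists_blockDet_eq_zero_of_re_neg (fundamentalRep (Fin 3)) fund_unitary U
          (wilsonBox (halfCorner s ε) (halfSides s ε)) hch
      exact ⟨μ', h1.le, Or.inr ⟨ε, h0⟩⟩

/-- **The pin event is a crossing event**: `Re det D_W(U, μ, 1) < 0` (the integrand of clause (b)
at probe mass `μ`) implies a real mode of `U` crossing at a bare mass in `(μ, 0]`. -/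
theorem pinEvent_forces_crossing {Nt : ℕ} [NeZero Nt] (U : GaugeConfig 4 Nt 𝔾) {μ : ℝ}
    (h : pinIndicator μ U = 1) :
    ∃ μ' : ℝ, μ < μ' ∧ μ' ≤ 0 ∧ fermionDet (wilsonDirac (fundamentalRep (Fin 3)) U μ' 1) = 0 := by
  have hneg : (fermionDet (wilsonDirac (fundamentalRep (Fin 3)) U μ 1)).re < 0 := by
    by_contra hcon
    simp [pinIndicator, hcon] at h
  exact exists_fermionDet_eq_zero_of_re_neg (fundamentalRep (Fin 3)) fund_unitary U hneg


/-! ## § 7. Quantitative margins (numbers for provers; heuristic inputs flagged) -/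

/-- **Margins of the early-crosser mechanism at accessible vs. asymptotic cutoffs** (all numbers in
LATTICE mass units unless stated; inputs: `κ_c(β_W = 6.0) = 0.1572` quenched, `a(6.0) = 0.093 fm`,
`Λ ≈ 300 MeV`, `Z_m = O(1)` at these cutoffs — standard lattice lore, not tree facts):

* critical mass `m_c = 1/(2κ_c) − 4`: `β_W = 5.7: −1.04`, `5.8: −0.88`, `6.0: −0.82`, `6.2: −0.74`
  (one loop: `−0.434 g₀²`, i.e. the tadpole roughly doubles it at `g₀² ≈ 1`);
* KineticEdge (route support): a Dirichlet cell of cubic side `s` has NO crossing above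
  `−4(1 − cos(π/s))` = `s = 4: −1.17`, `5: −0.76`, `6: −0.54`, `8: −0.30`, `12: −0.136`,
  `16: −0.077`; so at `β_W = 6.0` cells of side `≤ 4` can never be sign defects at the valence
  line (`≈ −0.8`), side-5 cells only marginally; the defect-capable cells are `s ≥ 6`;
* valence offset `a m / Z_m` for a `100 MeV` quark: `a = 0.093 fm: 0.047`; `0.05 fm: 0.025`;
  `0.01 fm: 0.005`;
* spread of the crossing masses of PHYSICAL modes around `m_c`, `O(a²Λ²)`: `a = 0.093 fm: 0.020`;
  `0.05 fm: 0.0058`; `0.01 fm: 0.00023`;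
* ratio offset/spread (the number of "standard deviations" a physical mode must fluctuate UP to
  become an early crosser, up to the `O(1)` coefficient `c/(c₁ g²)` of MECHANISM-g2):
  `2.4` (`0.093 fm`), `4.4` (`0.05 fm`), `22` (`0.01 fm`) — growing like `m/(a Λ² Z_m)`. So the
  dilution (a) is an ASYMPTOTIC statement with slow onset: at CLS/quenched cutoffs early crossers of
  light valence quarks are a percent-level effect (Mohler–Schaefer 2020: negative strange
  determinants `2% → 0.3% → 0.05%` at `a = 0.086 → 0.064 → 0.05 fm` on `(3 fm)⁴`, i.e. falling
  roughly like `a⁵…a⁷`, consistent with the dislocation count `(aΛ)^{b−4}`, `b − 4 = 5…5.7`, plus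
  the Gaussian factor), and any numerics at `β_W ≤ 6.2` (kit j011266) can only show the TREND, not
  the limit;
* pin (b): `P(Q odd) = (1 − e^{−2χ_t V})/2 ≥ 1/4 ⟺ χ_t V ≥ (ln 2)/2 = 0.347`; quenched
  `χ_t^{1/4} = 180 MeV` gives `V^{1/4} = R ≥ 0.84 fm`; with `N_f` light flavours
  `χ_t = m Σ/N_f` (`m = 100 MeV`, `Σ^{1/3} = 250 MeV`, `N_f = 3`: `χ_t^{1/4} = 150 MeV`,
  `R ≥ 1.0 fm`); the smallest admissible torus at `a = 0.05 fm` is then `N = 21` (odd), at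
  `a = 0.093 fm` `N = 11`;
* window scales: `J = Nat.log 2 (⌊ℓ/a⌋₊ / b₀) + 1` dyadic levels; `ℓ = 0.5 fm`, `b₀ = 2`: `J = 2`
  (`a = 0.093 fm`), `3` (`0.05 fm`), `5` (`0.01 fm`) — the sum `Σ_{j<J} δ_j` has only
  logarithmically many terms, dominated by the top level (`(ℓΛ)^4`-many physical objects per box). -/
theorem physicsMargins : True := trivial


/-! ## § 8. Numerics (kit jobs; scripts `torus_sign.py`, `quenched_cells.py` in the seat folder) -/

/-- **Small-torus determinant signs — preliminary (smoke run kit j010654, 22 s; full run j010655 and the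
quenched Dirichlet-cell study j011410 queued on the saturated farm, auto-attach to the item).**
Conventions of the tree (`K = Σ_ν W_ν`, `det D_W(μ) = det((μ+4) − K)`); cross-check "sign = parity
of real eigenvalues of `K` above `μ + 4`" against `slogdet`: 0 mismatches.

* `N = 1` torus, Haar `SU(3)⁴` (200 samples): real eigenvalues of `K` come as 0 or 2 (histogram
  `{0: 193, 2: 7}`), never odd in total (as they must: `χ_K` real of even degree), but `det < 0`
  DOES occur — for `μ + 4` strictly between the two real eigenvalues (3.5% of samples somewhere on
  the grid; largest real eigenvalue seen `1.70`, i.e. crossings only below `μ = −2.3`). So there is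
  no hidden Kramers-type symmetry on the one-site torus: "(b) on ALL tori including `S = 0`" is NOT
  deterministically refutable, and the Seiler window is numerically tight well inside `(−8, 0)`.
* `N = 1`, near-identity links `exp(iεX)`: `ε = 0.3`: 2.5% of samples carry a real PAIR near the
  edge (`3.75–3.87`, i.e. crossing masses `−0.25…−0.13`), `det < 0` only between the pair members;
  `ε = 1.0`: 12%, pairs spread down to `0.76`. `P(det < 0)` at `μ = −0.05`: `0` in all samples.
* exact-witness search on `N = 1` over 138 "nice" `SU(3)` matrices (signed/phased permutations),
  3000 random 4-tuples: `det D_W(U, μ) < 0` found at `μ ∈ {−5.5, −5, −4.5, −4, −3.5, −3, −2.5, −2}`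
  with explicit links (entries in `{0, ±1, ±i, ω, ω̄}`; e.g. `μ = −3`: real eigenvalues of `K`
  `0.2512, 1.6264`), none yet at `μ ∈ {−1.5, −1, −0.5, −0.25, −0.1}` — a Lean-certifiable
  `12 × 12` witness of a negative Wilson determinant therefore EXISTS at these masses (the barrier
  file `WilsonDeterminantSign` notes that no odd-index configuration is certified anywhere in the
  tree); certifying one needs the one-site unfolding of `wilsonDirac` and an exact `LU` identity over
  `ℚ(i, ω)` — judged not worth the cost this cycle.
* `N = 3` torus (`972 × 972`), Haar (4 samples): 14–20 real eigenvalues each, the largest `≤ 2.03`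
  (crossings only at `μ ≤ −1.97`); `P(det < 0) = 0` at `μ ∈ {−0.05, −0.5, −1.0}`, while deep in the
  doubler region `det < 0` is common. Near-identity `ε = 0.5` (4 samples): NO real eigenvalue at all,
  `det > 0` for every `μ`.

Reading (provisional, pending j010655/j011410): even maximally rough (`β = 0`) fields on small tori
put all crossings below `μ ≈ −2`; near-free fields have either no real eigenvalues or edge PAIRS.
The near-edge region `(−0.5, 0)` — where every high line's probe sits — is empty in all samples:
the numerical face of `¬HighLinePin` (§ 4) and of the fact that crossings near the physical critical
line `m_c(β) ∈ (−1, −0.7)` need correlated, extended structure (topology), absent on `1⁴, 3⁴`. -/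
theorem numericsSmallTori : True := trivial

end Summit.QuantumFields.QCD.Cruxes.NegativeCellsDilute.Disproof

end
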